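/- COR-CM (cell pub-hodgecm2) — Δ2 BRIDGE, ORIENTATION RE-KEY, Track T (conjugation TRANSPORT) AUDIT, wall-breaker wb-5
(prover-pub-hodgecm2-d2bridge-wb-5-g1-0).  THEOREMS + ONE def-by-formula (`conjRecord`); nothing landed is edited or restated;
no named fact, no `sorry`.  FRAMING: HC_CM is NOT proved; «Δ2 BRIDGE CLOSED» is NOT claimed. -/
import Summits.HodgeConjecture.CorCM.D2Bridge.CmClassesHodgeType
import Summits.HodgeConjecture.CorCM.D2Bridge.OrientationReflexConj
import Summits.HodgeConjecture.CorCM.D2Bridge.OrientationT2BlockVanishing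
import Literature.AlgebraicGeometry.HodgeTheory.AbelianVarietyHodgeHomFullnessHolds
import HarnessLib

/-!
# Δ2 bridge, Track T audit: conjugated CM records, the two `hcm` identities of the antilinear transport, and the vacuity of (T3′)

Track T (own-crow PROPOSAL T, pub-hodgecm2/INBOX l.12012; ASSEMBLER DECISION #19 (A)) transports the combined reading r8
(`LiuDictionary.Thm418C = Thm418Combined res cmClasses`) of a real-carrier dictionary at the pin `(V, ι₁)` along the ANTILINEAR
involution `F∞ = conj ⊗ id` of the tower and `c_W := HodgeStructure.conj` (`conj ⊗ id` on `U.CohC X 1 = ℂ ⊗_ℚ H¹(X; ℚ)`), swapping the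
index line `i` with its conjugate `ī` (`typeOfLine (line ī) = bar (typeOfLine (line i))`).  The semilinear transport frames (wb-10
`Thm418CTransport` ∕ `Thm418CSemilinearTransport`, wb-5 g2 `Thm418CConjTransport`) leave ONE generator-set law `hcm` relating
`cmClasses′ K ī` and `c_W '' cmClasses K i` as an explicit binder.  This file supplies, in the kernel:

* §1 `conjRecord d` — the CONJUGATE of a CM record `d : LiuCMSide` (same `K', Φ', M, k, A, ιA, θA, ΦA`; `τ ↦ conj ∘ τ`,
  `α ↦ (conj ⊗ id) α`; `α_mem` by `HodgeStructure.conj_baseChange`), an involution (`conjRecord_conjRecord`);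
* §2 `geomClass_conjRecord : geomClass K (conjRecord d) f = c_W (geomClass K d f)`; `cmClasses_eq_of_adm_iff` (two dictionaries whose
  admissibility predicates agree have THE SAME generator sets — the shape in which K1 = `isReflexOfTypeG_starRingEnd_comp_iff` makes the
  re-keyed `cmClasses′ K ī` LITERALLY the live `cmClasses K i`, `cmClasses_eq_of_isReflexOfTypeG_rekey`); and
  `cmClasses_eq_image_conj_of_adm_conjRecord` (a dictionary admitting `d` iff the other admits `conjRecord d` has generator set
  `c_W '' cmClasses` ON THE NOSE — the `hcm` EQUALITY the antilinear frame consumes, for the pair (T♭ := live dictionary with conjugated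
  records, T′ := re-keyed dictionary));
* §3 `isCorner_conjRecord_iff : (conjRecord d).IsCorner K Ψ σ ↔ d.IsCorner K Ψ (conj ∘ σ)` — the ONE residue Track T leaves at the
  junction's `hcorner` (the corner embedding is conjugated, nothing else);
* §4 THE VACUITY OF (T3′) AS SPECIFIED: `c_W` carries the `(1,0)`-piece of `H¹(P_K)` into the `(0,1)`-piece (`conj_mem_hodge_piece_zero_one`),
  so a generator set of type `(1,0)` contained in the `c_W`-image of itself is `{0}` (`eq_zero_of_mem_cmClasses_of_subset_conj_image`), and at
  a `PhiMu` character of the tower-built ∕ pinned dictionary `Thm418C` + that law force `block = ⊥` (`block_ofTower_eq_bot_of_thm418C_of_hcm_conj`,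
  `block_pin_eq_bot_of_thm418C_of_hcm_conj`): the composition «`Rekey.H418` + (T1)+(T2)+(T3′)+(T4) ⇒ live `h418`» is a theorem only where
  every `PhiMu` block vanishes.  What (T1)+(T2)+(T4) DO give is `Rekey.H418 ↔ (T♭).Thm418C` with §2's equality as `hcm`.

References: [Liu2021] Y. Liu, *Fourier–Jacobi cycles and arithmetic relative trace formula*, Camb. J. Math. 9 (2021), Thm. 4.18, Rem. 4.4;
[VoisinHodgeI2002] C. Voisin, *Hodge Theory and Complex Algebraic Geometry I*, §6.1.3 Cor. 6.12 ∕ 6.14, §7.1.1; [Shimura1998] G. Shimura,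
*Abelian Varieties with Complex Multiplication and Modular Functions*, §5.2, §8.3 Prop. 28.
-/

set_option autoImplicit false

noncomputable section

open scoped TensorProduct
open CategoryTheory Module

namespace Summit.HodgeConjecture.CorCM.D2Bridge

open Literature.AlgebraicGeometry.Motives (SchemeOver IsSmoothProjective CMType AbelianVariety bettiCohomology
  ofRatClassBaseChange ComplexPoints)
open Literature.AlgebraicGeometry.HodgeTheory (complexBetti IsOfHodgeType exists_isReal_hodgeModel hodgePQ_independent_of_hodgeModel
  conjClass_ofRatClassBaseChange)
open Literature.AlgebraicGeometry.HodgeTheory.BettiUniverse (pull cmAction)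
open Literature.NumberTheory.Automorphic.PicardCM
open Literature.NumberTheory.ComplexMultiplication.CMTypeOps (bar)
open Literature.NumberTheory.Transcendental (Arapura2012_Cor_15_4_6)
open HodgeCM HodgeCM.Model HodgeCM.Model.LiuDictionary
open HodgeCM.Literature.Theta HodgeCM.Literature.Theta.LiuAlbaneseModuleDatum
open HodgeCM.CM.CommonReflex (complexify mem_eigenline_complexify_iff)

/-! ## §0 Two lines of algebra on `conj ∘ (–)` for embeddings into `ℂ` -/

/-- `conj ∘ conj ∘ σ = σ`. [folklore] -/
private theorem conj_comp_conj_comp {R : Type*} [Semiring R] (σ : R →+* ℂ) :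
    (starRingEnd ℂ).comp ((starRingEnd ℂ).comp σ) = σ :=
  RingHom.ext fun x => Complex.conj_conj (σ x)

/-- `conj ∘ F = σ ↔ F = conj ∘ σ`. [folklore] -/
private theorem conj_comp_eq_iff {R : Type*} [Semiring R] (F σ : R →+* ℂ) :
    (starRingEnd ℂ).comp F = σ ↔ F = (starRingEnd ℂ).comp σ := by
  constructor
  · rintro rfl
    exact (conj_comp_conj_comp F).symm
  · rintro rfl
    exact conj_comp_conj_comp σ

/-! ## §1 The conjugate of a CM record -/

/-- **The CONJUGATE CM record** `d̄` of `d = (K', Φ', M, k, A, ιA, θA, ΦA, τ, α)`: the SAME abelian variety with the SAME CM structure and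
reflex data, the eigencharacter conjugated `τ ↦ conj ∘ τ` and the class conjugated `α ↦ (conj ⊗ id) α` — `(conj ⊗ id) α` is a
`(conj ∘ τ)`-eigenvector because the complexified CM action `θA(a) ⊗ 1` commutes with `conj ⊗ id` (`HodgeStructure.conj_baseChange`).
If `d.α` is of Hodge type `(1,0)` (`τ ∈ ΦA`) then `d̄.α` is of type `(0,1)` (`conj ∘ τ ∉ ΦA`), and conversely.
[cite: VoisinHodgeI2002, §6.1.3 Cor. 6.12] [cite: Shimura1998, §5.2 (pp. 36–37)] -/
def conjRecord (d : LiuCMSide) : LiuCMSide :=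
  { d with
    τ := (starRingEnd ℂ).comp d.τ
    α := Literature.AlgebraicGeometry.Motives.HodgeStructure.conj d.α
    α_mem := by
      have h := (mem_eigenline_complexify_iff _ _ _).1 d.α_mem
      refine (mem_eigenline_complexify_iff _ _ _).2 fun a => ?_
      rw [← Literature.AlgebraicGeometry.Motives.HodgeStructure.conj_baseChange, h a,
        Literature.AlgebraicGeometry.Motives.HodgeStructure.conj_smul]
      rfl }

/-- (unfolding) the conjugate record has the same abelian variety. [folklore] -/
theorem conjRecord_A (d : LiuCMSide) : (conjRecord d).A = d.A := rfl

/-- (unfolding) `d̄.τ = conj ∘ d.τ`. [folklore] -/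
theorem conjRecord_τ (d : LiuCMSide) : (conjRecord d).τ = (starRingEnd ℂ).comp d.τ := rfl

/-- (unfolding) `d̄.α = (conj ⊗ id) d.α`. [folklore] -/
theorem conjRecord_α (d : LiuCMSide) :
    (conjRecord d).α = Literature.AlgebraicGeometry.Motives.HodgeStructure.conj d.α := rfl

/-- (unfolding) `d̄.ΦA = d.ΦA`, `d̄.Φ' = d.Φ'`, `d̄.k = d.k` — the reflex data and the CM type are untouched. [folklore] -/
theorem conjRecord_ΦA (d : LiuCMSide) : (conjRecord d).ΦA = d.ΦA := rfl

/-- **Conjugation of records is an involution.** [folklore] -/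
theorem conjRecord_conjRecord (d : LiuCMSide) : conjRecord (conjRecord d) = d := by
  -- a record is determined by its fields; only `τ`, `α` (and the proof `α_mem`) move, and they move back
  have key : ∀ (τ : d.M →+* ℂ) (α : ℂ ⊗[ℚ] bettiCohomology d.A.X 1)
      (hα : α ∈ eigenline (complexify (cmAction d.θA d.isRealisation.isInducedOnIntegers)) τ),
      τ = d.τ → α = d.α → ({ d with τ := τ, α := α, α_mem := hα } : LiuCMSide) = d := by
    rintro τ α hα rfl rfl
    rfl
  exact key _ _ _ (conj_comp_conj_comp d.τ)
    (Literature.AlgebraicGeometry.Motives.HodgeStructure.conj_conj d.α)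

/-- `d̄.τ ∈ d̄.ΦA ↔ conj ∘ d.τ ∈ d.ΦA` (unfolding). [folklore] -/
theorem conjRecord_τ_mem_iff (d : LiuCMSide) : (conjRecord d).τ ∈ (conjRecord d).ΦA.1 ↔ (starRingEnd ℂ).comp d.τ ∈ d.ΦA.1 :=
  Iff.rfl

/-! ## §2 Geometric classes and generator sets under record conjugation; the two `hcm` identities -/

section Classes

variable {hHD : exists_isReal_hodgeModel} {hI : hodgePQ_independent_of_hodgeModel}
  {h₁ : BallQuotientUniformised} {h₃ : CMAbelianVarietyRealised}
variable {L : CMField} {ι₁ : (L : Type) →+* ℂ} {V : HermSpace3 L ι₁}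

/-- **`f^* ᾱ = c_W (f^* α)`**: the geometric class of the conjugate record along the SAME `ℂ`-morphism `f : P_K ⟶ d.A.X` is the
`c_W = conj ⊗ id`-conjugate of the geometric class of `d` (`conj ⊗ id` commutes with `f^* ⊗ ℂ`). [cite: VoisinHodgeI2002, §6.1.3 Cor. 6.12] -/
theorem geomClass_conjRecord (K : Level V) (d : LiuCMSide)
    (f : (pmsRealisation (ballQuotientUniformisedDatum_of h₁) (pmsCode L ι₁ V K)).X ⟶ d.A.X) :
    geomClass (hHD := hHD) (hI := hI) (h₁ := h₁) (h₃ := h₃) K (conjRecord d) f =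
      Literature.AlgebraicGeometry.Motives.HodgeStructure.conj (geomClass (hHD := hHD) (hI := hI) (h₁ := h₁) (h₃ := h₃) K d f) := by
  simp only [geomClass, conjRecord_α]
  exact (Literature.AlgebraicGeometry.Motives.HodgeStructure.conj_baseChange _ _).symm

/-- **Dictionaries whose admissibility predicates agree at `(μ₁, μ₂)` have the same generator set there** — `cmClasses` sees only `adm`
and the key-free `geomClass`. [folklore] -/
theorem cmClasses_eq_of_adm_iff (T₁ T₂ : LiuDictionary hHD hI h₁ h₃ V) (K : Level V) (μ₁ : T₁.Char) (μ₂ : T₂.Char)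
    (h : ∀ d : LiuCMSide, T₂.adm μ₂ d ↔ T₁.adm μ₁ d) : T₂.cmClasses K μ₂ = T₁.cmClasses K μ₁ := by
  ext x
  simp only [cmClasses, Set.mem_iUnion, Set.mem_range, h]

/-- **FIRST `hcm` IDENTITY (re-key vs live, by K1): `cmClasses′ K ī = cmClasses K i` ON THE NOSE.**  If `T₂` is keyed at the conjugate pin
embedding, `T₂.adm μ₂ d ↔ d.IsReflexOfTypeG ῑ₁ Φ`, and `T₁` at `ι₁` with the conjugate type, `T₁.adm μ₁ d ↔ d.IsReflexOfTypeG ι₁ (bar Φ)` (the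
situation `Φ = typeOfLine (line ī)`, `bar Φ = typeOfLine (line i)`), then the generator sets COINCIDE: K1
(`isReflexOfTypeG_starRingEnd_comp_iff`, a statement about ONE record `d`) — the re-key moves NO record.
[cite: Liu2021, Remark 4.4 (TeX ll. 1930–1933)] [cite: Shimura1998, §8.3 Prop. 28] -/
theorem cmClasses_eq_of_isReflexOfTypeG_rekey (T₁ T₂ : LiuDictionary hHD hI h₁ h₃ V) (K : Level V) (μ₁ : T₁.Char) (μ₂ : T₂.Char)
    (Φ : CMType (L : Type))
    (h₂ : ∀ d : LiuCMSide, T₂.adm μ₂ d ↔ d.IsReflexOfTypeG ((starRingEnd ℂ).comp ι₁) Φ)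
    (h₁' : ∀ d : LiuCMSide, T₁.adm μ₁ d ↔ d.IsReflexOfTypeG ι₁ (bar Φ)) :
    T₂.cmClasses K μ₂ = T₁.cmClasses K μ₁ :=
  cmClasses_eq_of_adm_iff T₁ T₂ K μ₁ μ₂ fun d => by rw [h₂ d, h₁' d, isReflexOfTypeG_starRingEnd_comp_iff ι₁ d Φ]

/-- **SECOND `hcm` IDENTITY (conjugated records): `T♭.cmClasses K μ♭ = c_W '' T.cmClasses K μ` ON THE NOSE** whenever `T♭` admits `d` at `μ♭`
iff `T` admits `d̄` at `μ` — reindex the comprehension by the involution `d ↦ d̄` and use `geomClass_conjRecord`.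
[cite: VoisinHodgeI2002, §6.1.3 Cor. 6.12] -/
theorem cmClasses_eq_image_conj_of_adm_conjRecord (T Tf : LiuDictionary hHD hI h₁ h₃ V) (K : Level V) (μ : T.Char) (μf : Tf.Char)
    (h : ∀ d : LiuCMSide, Tf.adm μf d ↔ T.adm μ (conjRecord d)) :
    Tf.cmClasses K μf = Literature.AlgebraicGeometry.Motives.HodgeStructure.conj '' T.cmClasses K μ := by
  ext x
  simp only [cmClasses, Set.mem_iUnion, Set.mem_range, Set.mem_image]
  constructor
  · rintro ⟨d, hd, f, rfl⟩
    refine ⟨geomClass (hHD := hHD) (hI := hI) (h₁ := h₁) (h₃ := h₃) K (conjRecord d) f, ⟨conjRecord d, (h d).1 hd, f, rfl⟩, ?_⟩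
    rw [geomClass_conjRecord, Literature.AlgebraicGeometry.Motives.HodgeStructure.conj_conj]
  · rintro ⟨y, ⟨d, hd, f, rfl⟩, rfl⟩
    have hd' : T.adm μ (conjRecord (conjRecord d)) := by rwa [conjRecord_conjRecord]
    exact ⟨conjRecord d, (h (conjRecord d)).2 hd', f, geomClass_conjRecord K d f⟩

end Classes

/-! ## §3 The corner predicate under record conjugation: only the corner embedding moves -/

/-- **`d̄.IsCorner K Ψ σ ↔ d.IsCorner K Ψ (conj ∘ σ)`** — the reflex pair `(K', Φ')` of `d̄` is that of `d`; only the embedding clause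
`τ ∘ k ∘ e = σ` is conjugated.  (The junction's `hcorner` through conjugated records therefore matches the corner `(K, Ψ, conj ∘ σ)`.)
[cite: Liu2021, Remark 4.4 (TeX ll. 1930–1933)] -/
theorem isCorner_conjRecord_iff (d : LiuCMSide) (K : CMField) (Ψ : CMType (K : Type)) (σ : (K : Type) →+* ℂ) :
    (conjRecord d).IsCorner K Ψ σ ↔ d.IsCorner K Ψ ((starRingEnd ℂ).comp σ) := by
  refine exists_congr fun e => and_congr_right fun _ => ?_
  change ((starRingEnd ℂ).comp d.τ).comp (d.k.comp e.toRingHom) = σ ↔ d.τ.comp (d.k.comp e.toRingHom) = (starRingEnd ℂ).comp σ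
  rw [RingHom.comp_assoc]
  exact conj_comp_eq_iff _ _

/-! ## §4 The vacuity of (T3′): a `(1,0)` generator set inside the conjugate-image of itself is `{0}`, and then `Thm418C` kills the block -/

section Vacuity

variable {hHD : exists_isReal_hodgeModel} {hI : hodgePQ_independent_of_hodgeModel}
  {h₁ : BallQuotientUniformised} {h₃ : CMAbelianVarietyRealised}
variable {L : CMField} {ι₁ : (L : Type) →+* ℂ} {V : HermSpace3 L ι₁}

/-- **`c_W = conj ⊗ id` carries `H^{1,0}(P_K)` into `H^{0,1}(P_K)`** (Hodge symmetry of the real Hodge structure of the realising surface,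
read through `β : ℂ ⊗_ℚ H¹ ≃ H¹(–; ℂ)`: `β ∘ (conj ⊗ id) = conj ∘ β`). [cite: VoisinHodgeI2002, §6.1.3 Cor. 6.12] -/
theorem conj_mem_hodge_piece_zero_one (K : Level V)
    {x : (picardCMUniverse hHD hI h₁ h₃).CohC ((picardCMUniverse hHD hI h₁ h₃).pms L ι₁ V K) 1}
    (hx : x ∈ ((picardCMUniverse hHD hI h₁ h₃).hodge ((picardCMUniverse hHD hI h₁ h₃).pms L ι₁ V K) 1).piece 1 0) :
    Literature.AlgebraicGeometry.Motives.HodgeStructure.conj x ∈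
      ((picardCMUniverse hHD hI h₁ h₃).hodge ((picardCMUniverse hHD hI h₁ h₃).pms L ι₁ V K) 1).piece 0 1 := by
  rw [hodge_pms_eq] at hx ⊢
  have h10 := (Literature.AlgebraicGeometry.HodgeTheory.BettiUniverse.mem_hodge_piece_iff hHD hI
    (isSmoothProjective_pms (h₁ := h₁) K) (k := 1) (p := 1) (q := 0) rfl x).1 hx
  have h01 := h10.conjClass (isSmoothProjective_pms (h₁ := h₁) K)
  rw [conjClass_ofRatClassBaseChange] at h01
  exact (Literature.AlgebraicGeometry.HodgeTheory.BettiUniverse.mem_hodge_piece_iff hHD hI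
    (isSmoothProjective_pms (h₁ := h₁) K) (k := 1) (p := 0) (q := 1) rfl _).2 h01

/-- **A `(1,0)` generator set contained in the `c_W`-image of itself is `{0}`.**  (Applied to `T.cmClasses K μ` at a character whose admissible
records have their eigencharacter IN their CM type: `x = c_W y` with `x, y` of type `(1,0)` puts `x` in `H^{1,0} ∩ H^{0,1} = 0`.)
[cite: VoisinHodgeI2002, §6.1.3 Cor. 6.14] -/
theorem eq_zero_of_mem_cmClasses_of_subset_conj_image (T : LiuDictionary hHD hI h₁ h₃ V) (K : Level V) (μ : T.Char)
    (hadm : ∀ d : LiuCMSide, T.adm μ d → d.τ ∈ d.ΦA.1)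
    (hcm : T.cmClasses K μ ⊆ Literature.AlgebraicGeometry.Motives.HodgeStructure.conj '' T.cmClasses K μ)
    {x : (picardCMUniverse hHD hI h₁ h₃).CohC ((picardCMUniverse hHD hI h₁ h₃).pms L ι₁ V K) 1} (hx : x ∈ T.cmClasses K μ) :
    x = 0 := by
  have h10 : x ∈ ((picardCMUniverse hHD hI h₁ h₃).hodge ((picardCMUniverse hHD hI h₁ h₃).pms L ι₁ V K) 1).piece 1 0 :=
    cmClasses_subset_hodge_piece_one_zero T K μ hadm hx
  obtain ⟨y, hy, rfl⟩ := hcm hx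
  have h01 : Literature.AlgebraicGeometry.Motives.HodgeStructure.conj y ∈
      ((picardCMUniverse hHD hI h₁ h₃).hodge ((picardCMUniverse hHD hI h₁ h₃).pms L ι₁ V K) 1).piece 0 1 :=
    conj_mem_hodge_piece_zero_one K (cmClasses_subset_hodge_piece_one_zero T K μ hadm hy)
  exact (Submodule.disjoint_def.1 (disjoint_hodgePiece_one_zero hHD hI h₁ h₃ K)) _ h10 h01

/-- **… so under that law r8 makes every `K`-fixed block vector restrict to `0` below a threshold** (`Thm418C` at a `PhiMu` character with
`span (cmClasses K μ) = 0` at every level). [cite: Liu2021, Thm. 4.18] [cite: VoisinHodgeI2002, §6.1.3 Cor. 6.14] -/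
theorem res_eq_zero_of_thm418C_of_hcm_conj (T : LiuDictionary hHD hI h₁ h₃ V) (h418 : T.Thm418C) (μ : T.Char) (hΦ : T.PhiMu μ)
    (hadm : ∀ d : LiuCMSide, T.adm μ d → d.τ ∈ d.ΦA.1)
    (hcm : ∀ K : Level V, T.cmClasses K μ ⊆ Literature.AlgebraicGeometry.Motives.HodgeStructure.conj '' T.cmClasses K μ) :
    ∃ Γ₀ : Level V, ∀ Γ ≤ Γ₀, ∀ x ∈ T.block μ, x ∈ fixedBy Γ.K T.H → T.res Γ x = 0 := by
  refine res_eq_zero_of_thm418C_of_disjoint hHD hI h₁ h₃ T h418 μ hΦ (fun _ => ⊥) (fun _ => ⊤) (fun _ => disjoint_bot_left)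
    (fun K x hx => ?_) ⟨Level.three V, fun _ _ _ _ _ => Submodule.mem_top⟩
  rw [eq_zero_of_mem_cmClasses_of_subset_conj_image T K μ hadm (hcm K) hx]
  exact Submodule.zero_mem _

variable (V)
variable (Char : Type) (Adm : Char → Type) (Ω : (μ : Char) → Adm μ → Type)
    [∀ μ a, AddCommGroup (Ω μ a)] [∀ μ a, Module ℂ (Ω μ a)] [∀ μ a, Module (adelicAlgebra V) (Ω μ a)]
    [∀ μ a, IsScalarTower ℂ (adelicAlgebra V) (Ω μ a)] (PhiMu : Char → Prop) (adm : Char → LiuCMSide → Prop)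

/-- **THE VACUITY OF (T3′) at the tower-built dictionary: `Thm418C` + «records at `μ` have `τ ∈ ΦA`» + the (T3′)-law
`cmClasses K μ ⊆ c_W '' cmClasses K μ` (all `K`) ⇒ `block μ = ⊥`** (the tower separates: `block_ofTower_eq_bot_of_res_eq_zero`).
[cite: Liu2021, Thm. 4.18] [cite: VoisinHodgeI2002, §6.1.3 Cor. 6.14] -/
theorem block_ofTower_eq_bot_of_thm418C_of_hcm_conj (hHD : exists_isReal_hodgeModel) (hI : hodgePQ_independent_of_hodgeModel)
    (h₁ : BallQuotientUniformised) (h₃ : CMAbelianVarietyRealised) (hA : Arapura2012_Cor_15_4_6) (μ : Char)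
    (h418 : (LiuDictionary.ofTower hHD hI h₁ h₃ hA V Char Adm Ω PhiMu adm).Thm418C) (hΦ : PhiMu μ)
    (hadm : ∀ d : LiuCMSide, adm μ d → d.τ ∈ d.ΦA.1)
    (hcm : ∀ K : Level V, (LiuDictionary.ofTower hHD hI h₁ h₃ hA V Char Adm Ω PhiMu adm).cmClasses K μ ⊆
      Literature.AlgebraicGeometry.Motives.HodgeStructure.conj '' (LiuDictionary.ofTower hHD hI h₁ h₃ hA V Char Adm Ω PhiMu adm).cmClasses K μ) :
    (LiuDictionary.ofTower hHD hI h₁ h₃ hA V Char Adm Ω PhiMu adm).block μ = ⊥ :=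
  block_ofTower_eq_bot_of_res_eq_zero V Char Adm Ω PhiMu adm hHD hI h₁ h₃ hA μ
    (res_eq_zero_of_thm418C_of_hcm_conj (LiuDictionary.ofTower hHD hI h₁ h₃ hA V Char Adm Ω PhiMu adm) h418 μ hΦ hadm hcm)

variable (I : Type) (line : I → SplitLineE V)

/-- **THE VACUITY OF (T3′) AT THE LITERAL PIN** `liuDictionaryPin hHD hI h₁ h₃ hA V I line`, `L/ℚ` Galois: at an index line `i` with `PhiMu i`
(`ι₁ ∈ typeOfLine (line i)`), `Thm418C` (= the live `h418` at this pin) together with Track T's law in its (T3′) form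
«`cmClasses K i ⊆ c_W '' cmClasses K i`» — which is what `cmClasses′ K ī ⊆ c_W '' cmClasses K i` SAYS, by
`cmClasses_eq_of_isReflexOfTypeG_rekey` — forces `block i = ⊥`.  So «`Rekey.H418` + (T1)+(T2)+(T3′)+(T4) ⇒ `h418`» holds only where
every `PhiMu` block vanishes. [cite: Liu2021, Thm. 4.18] [cite: VoisinHodgeI2002, §6.1.3 Cor. 6.14] [cite: Shimura1998, §8.3 Prop. 28] -/
theorem block_pin_eq_bot_of_thm418C_of_hcm_conj [IsGalois ℚ (L : Type)] (hHD : exists_isReal_hodgeModel)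
    (hI : hodgePQ_independent_of_hodgeModel) (h₁ : BallQuotientUniformised) (h₃ : CMAbelianVarietyRealised)
    (hA : Arapura2012_Cor_15_4_6) (i : I)
    (h418 : (liuDictionaryPin hHD hI h₁ h₃ hA V I line).Thm418C) (hΦ : (liuDictionaryPin hHD hI h₁ h₃ hA V I line).PhiMu i)
    (hcm : ∀ K : Level V, (liuDictionaryPin hHD hI h₁ h₃ hA V I line).cmClasses K i ⊆
      Literature.AlgebraicGeometry.Motives.HodgeStructure.conj '' (liuDictionaryPin hHD hI h₁ h₃ hA V I line).cmClasses K i) :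
    (liuDictionaryPin hHD hI h₁ h₃ hA V I line).block i = ⊥ :=
  block_ofTower_eq_bot_of_thm418C_of_hcm_conj V _ _ _ _ _ hHD hI h₁ h₃ hA i h418 hΦ
    (fun d hd => tau_mem_cmType_of_isReflexOfType ι₁ d (SplitLine.typeOfLine (line i)) (hd inferInstance) hΦ) hcm

end Vacuity

end Summit.HodgeConjecture.CorCM.D2Bridge

end
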